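import Summits.Ventures.Crystal3D.Theorems.StickyWulffConstantTextureBuildSlabPlates
import HarnessLib

/-!
# TB-1 brick S5(c): THE WALL CELL OF TWO CLEAN COLUMNS — a `PlacedCell` from the grains' ACTUAL presentations and a placement, plates complete by completeness
# (lane T, crux `TextureLiminfV5`, stmt-Ventures-23912; memo HOME/wulff-p2/g25/SLAB-PLATES-g25.md §7 (b), §8)

HONEST FRAMING. Venture `Summits/Ventures/Crystal3D` (cell `crystal3d-full`), route `route-Ventures-StickyWulffConstant`, helper `--supports` the
law-v5 crux `TextureLiminfV5` (stmt-Ventures-23912).  Frame bookkeeping (census-free, standard axioms) over '…WallCellOfPlates' (`PlacedCell.ofComplete`) and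
'…SlabPlates' (`rigid_mem_stacking_iff`, `rigid_image_stacking`, `mem_pullback_iff`).  No cover is built, no wall law is proved; F-C1 not moved.

WHY.  The constructor of the healed `stub_TB_cover` holds, on each side of a flat wall piece, the grain's presentation in ACTUAL coordinates — `S_f = stacking L_f b_f s_f`
below, `S_g = stacking L_g b_g s_g` above (descent '…DescentFromShell', or a charted block) — certified complete on a cylinder ('…ColumnClean' `column_clean` (b):
every site in the cylinder is a ball), and chooses a placement `p ↦ M p + t` of the model cylinder `cyl R₀ h ρ` whose two plate slabs lie inside those cylinders.
This file turns exactly that into the cell the cover needs, with the identities the mesh needs: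

* `trans_symm_trans_self` — `(L.trans M⁻¹).trans M = L`;
* **`exists_placedCell_of_windows`** — given a `1`-separated `X'`, Hägg words, the two presentations and the placement, and the two WINDOW facts «every site of
  `S_f` whose model height is in `[−2R₀, −R₀]` and model radius `≤ ρ` is in `X'`» / «… of `S_g` with model height in `[h + R₀, h + 2R₀]` …», a
  `pc : PlacedCell C R₀ X'` with `pc.M = M`, `pc.t = t`, `pc.h = h`, `pc.ρ = ρ`, the `Mesh.hS₁/hS₂` identities `rigid M t '' stacking pc.L₁ pc.s₁ pc.σ₁ = S_f`,
  `… = S_g`, the FULL law table (`Mesh.hlaw` clause), and `hfull`: every ball of `X'` whose model position lies in `cyl R₀ h ρ` is a ball of the cell.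
-/

noncomputable section

open scoped BigOperators InnerProductSpace

namespace Summit.Ventures.Crystal3D.Cruxes.TextureLiminf.TexShadow

open Summit.Ventures.Crystal3D Summit.Ventures.Crystal3D.Theorems
open Literature.MathematicalPhysics.StatisticalMechanics (IsHaggSeq)

/-- `(L.trans M⁻¹).trans M = L`. -/
theorem trans_symm_trans_self (L M : E3 ≃ₗᵢ[ℝ] E3) : (L.trans M.symm).trans M = L := by
  ext r
  simp

/-- `M (M⁻¹ (b − t)) + t = b`. -/
theorem apply_symm_sub_add (M : E3 ≃ₗᵢ[ℝ] E3) (b t : E3) : M (M.symm (b - t)) + t = b := by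
  rw [LinearIsometryEquiv.apply_symm_apply, sub_add_cancel]

section Cell

variable (C R₀ : ℝ) {σ_f σ_g : ℤ → ℤ} (hσ_f : IsHaggSeq σ_f) (hσ_g : IsHaggSeq σ_g) (L_f L_g : E3 ≃ₗᵢ[ℝ] E3) (b_f b_g : E3)
  {h ρ : ℝ} (hR₀ : 0 < R₀) (hh : 0 ≤ h) (hρ : R₀ ≤ ρ) (X' : Finset E3) (hX' : ∀ p ∈ X', ∀ q ∈ X', p ≠ q → 1 ≤ dist p q)
  (M : E3 ≃ₗᵢ[ℝ] E3) (t : E3)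

include hσ_f hσ_g hR₀ hh hρ hX' in
/-- **THE WALL CELL OF TWO CLEAN COLUMNS.**  See the module docstring. -/
theorem exists_placedCell_of_windows
    (hf : ∀ w ∈ stacking L_f b_f σ_f, -(2 * R₀) ≤ (M.symm (w - t)) 2 → (M.symm (w - t)) 2 ≤ -R₀ →
      (M.symm (w - t)) 0 ^ 2 + (M.symm (w - t)) 1 ^ 2 ≤ ρ ^ 2 → w ∈ X')
    (hg : ∀ w ∈ stacking L_g b_g σ_g, h + R₀ ≤ (M.symm (w - t)) 2 → (M.symm (w - t)) 2 ≤ h + 2 * R₀ →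
      (M.symm (w - t)) 0 ^ 2 + (M.symm (w - t)) 1 ^ 2 ≤ ρ ^ 2 → w ∈ X') :
    ∃ pc : PlacedCell C R₀ X', pc.M = M ∧ pc.t = t ∧ pc.h = h ∧ pc.ρ = ρ ∧
      rigid M t '' stacking pc.L₁ pc.s₁ pc.σ₁ = stacking L_f b_f σ_f ∧
      rigid M t '' stacking pc.L₂ pc.s₂ pc.σ₂ = stacking L_g b_g σ_g ∧
      (∀ i j : ℤ, (¬ CoAx (pc.A₁ i) (pc.A₂ j) → (13 / 25 : ℝ) ≤ pc.c i j) ∧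
        (CoAx (pc.A₁ i) (pc.A₂ j) → pc.A₁ i '' fccRef ≠ pc.A₂ j '' fccRef → 1 / 2 * Real.sqrt (1 - ⟪pc.m i j, e₃⟫_ℝ ^ 2) ≤ pc.c i j)) ∧
      (∀ q ∈ X', M.symm (q - t) ∈ cyl R₀ h ρ → M.symm (q - t) ∈ pc.X) := by
  classical
  -- the model stackings: pull the actual presentations back by the placement
  set L₁ : E3 ≃ₗᵢ[ℝ] E3 := L_f.trans M.symm with hL₁
  set L₂ : E3 ≃ₗᵢ[ℝ] E3 := L_g.trans M.symm with hL₂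
  set s₁ : E3 := M.symm (b_f - t) with hs₁
  set s₂ : E3 := M.symm (b_g - t) with hs₂
  have himg₁ : rigid M t '' stacking L₁ s₁ σ_f = stacking L_f b_f σ_f := by
    rw [rigid_image_stacking, hL₁, hs₁, trans_symm_trans_self, apply_symm_sub_add]
  have himg₂ : rigid M t '' stacking L₂ s₂ σ_g = stacking L_g b_g σ_g := by
    rw [rigid_image_stacking, hL₂, hs₂, trans_symm_trans_self, apply_symm_sub_add]
  have hmem₁ : ∀ p, p ∈ stacking L₁ s₁ σ_f → rigid M t p ∈ stacking L_f b_f σ_f := fun p hp => by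
    rw [← himg₁]; exact ⟨p, hp, rfl⟩
  have hmem₂ : ∀ p, p ∈ stacking L₂ s₂ σ_g → rigid M t p ∈ stacking L_g b_g σ_g := fun p hp => by
    rw [← himg₂]; exact ⟨p, hp, rfl⟩
  have hsymm : ∀ p : E3, M.symm (rigid M t p - t) = p := fun p => by
    show M.symm (M p + t - t) = p
    rw [add_sub_cancel_right, LinearIsometryEquiv.symm_apply_apply]
  -- the two plate hypotheses of `PlacedCell.ofComplete`
  have hc₁ : ∀ p ∈ stacking L₁ s₁ σ_f, -(2 * R₀) ≤ p 2 → p 2 ≤ -R₀ → p 0 ^ 2 + p 1 ^ 2 ≤ ρ ^ 2 → p ∈ pullback X' M t := by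
    intro p hp h1 h2 h3
    rw [mem_pullback_iff]
    have hw := hf (rigid M t p) (hmem₁ p hp)
    rw [hsymm] at hw
    exact hw h1 h2 h3
  have hc₂ : ∀ p ∈ stacking L₂ s₂ σ_g, h + R₀ ≤ p 2 → p 2 ≤ h + 2 * R₀ → p 0 ^ 2 + p 1 ^ 2 ≤ ρ ^ 2 → p ∈ pullback X' M t := by
    intro p hp h1 h2 h3
    rw [mem_pullback_iff]
    have hw := hg (rigid M t p) (hmem₂ p hp)
    rw [hsymm] at hw
    exact hw h1 h2 h3
  refine ⟨PlacedCell.ofComplete C R₀ hσ_f hσ_g L₁ L₂ s₁ s₂ hR₀ hh hρ X' M t hc₁ hc₂ hX', rfl, rfl, rfl, rfl, himg₁, himg₂, ?_, ?_⟩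
  · intro i j
    exact WallCell.ofComplete_full C R₀ hσ_f hσ_g L₁ L₂ s₁ s₂ hR₀ hh hρ (pullback X' M t) (pullback_sep X' M t hX') hc₁ hc₂ i j
  · intro q hq hcyl
    have hqp : M.symm (q - t) ∈ pullback X' M t := by
      rw [mem_pullback_iff]
      have : rigid M t (M.symm (q - t)) = q := rigid_symm_apply M t q
      rw [this]; exact hq
    exact WallCell.ofComplete_mem_X C R₀ hσ_f hσ_g L₁ L₂ s₁ s₂ hR₀ hh hρ (pullback X' M t) (pullback_sep X' M t hX') hc₁ hc₂ hqp hcyl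

end Cell

/-! ## Appended: the same cell with the PRESENTATION identities of `Mesh₄.hpres₁/hpres₂` (pointwise frame identity and equal Hägg words) -/

section CellPres

variable (C R₀ : ℝ) {σ_f σ_g : ℤ → ℤ} (hσ_f : IsHaggSeq σ_f) (hσ_g : IsHaggSeq σ_g) (L_f L_g : E3 ≃ₗᵢ[ℝ] E3) (b_f b_g : E3)
  {h ρ : ℝ} (hR₀ : 0 < R₀) (hh : 0 ≤ h) (hρ : R₀ ≤ ρ) (X' : Finset E3) (hX' : ∀ p ∈ X', ∀ q ∈ X', p ≠ q → 1 ≤ dist p q)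
  (M : E3 ≃ₗᵢ[ℝ] E3) (t : E3)

include hσ_f hσ_g hR₀ hh hρ hX' in
/-- **THE WALL CELL OF TWO CLEAN COLUMNS, with presentations**: as `exists_placedCell_of_windows`, exporting in addition the POINTWISE identities
`rigid M t (pc.L₁ r + pc.s₁) = L_f r + b_f`, `rigid M t (pc.L₂ r + pc.s₂) = L_g r + b_g` and `pc.σ₁ = σ_f`, `pc.σ₂ = σ_g` — literally the clauses of
`Mesh₄.hpres₁ / hpres₂` when the tents of the two grains are presented as `(L_f, b_f, σ_f)`, `(L_g, b_g, σ_g)`. -/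
theorem exists_placedCell_of_windows_pres
    (hf : ∀ w ∈ stacking L_f b_f σ_f, -(2 * R₀) ≤ (M.symm (w - t)) 2 → (M.symm (w - t)) 2 ≤ -R₀ →
      (M.symm (w - t)) 0 ^ 2 + (M.symm (w - t)) 1 ^ 2 ≤ ρ ^ 2 → w ∈ X')
    (hg : ∀ w ∈ stacking L_g b_g σ_g, h + R₀ ≤ (M.symm (w - t)) 2 → (M.symm (w - t)) 2 ≤ h + 2 * R₀ →
      (M.symm (w - t)) 0 ^ 2 + (M.symm (w - t)) 1 ^ 2 ≤ ρ ^ 2 → w ∈ X') :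
    ∃ pc : PlacedCell C R₀ X', pc.M = M ∧ pc.t = t ∧ pc.h = h ∧ pc.ρ = ρ ∧
      ((∀ r : E3, rigid M t (pc.L₁ r + pc.s₁) = L_f r + b_f) ∧ pc.σ₁ = σ_f) ∧
      ((∀ r : E3, rigid M t (pc.L₂ r + pc.s₂) = L_g r + b_g) ∧ pc.σ₂ = σ_g) ∧
      rigid M t '' stacking pc.L₁ pc.s₁ pc.σ₁ = stacking L_f b_f σ_f ∧
      rigid M t '' stacking pc.L₂ pc.s₂ pc.σ₂ = stacking L_g b_g σ_g ∧
      (∀ i j : ℤ, (¬ CoAx (pc.A₁ i) (pc.A₂ j) → (13 / 25 : ℝ) ≤ pc.c i j) ∧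
        (CoAx (pc.A₁ i) (pc.A₂ j) → pc.A₁ i '' fccRef ≠ pc.A₂ j '' fccRef → 1 / 2 * Real.sqrt (1 - ⟪pc.m i j, e₃⟫_ℝ ^ 2) ≤ pc.c i j)) ∧
      (∀ q ∈ X', M.symm (q - t) ∈ cyl R₀ h ρ → M.symm (q - t) ∈ pc.X) := by
  classical
  set L₁ : E3 ≃ₗᵢ[ℝ] E3 := L_f.trans M.symm with hL₁
  set L₂ : E3 ≃ₗᵢ[ℝ] E3 := L_g.trans M.symm with hL₂
  set s₁ : E3 := M.symm (b_f - t) with hs₁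
  set s₂ : E3 := M.symm (b_g - t) with hs₂
  have hpt₁ : ∀ r : E3, rigid M t (L₁ r + s₁) = L_f r + b_f := fun r => by
    show M ((L_f.trans M.symm) r + M.symm (b_f - t)) + t = L_f r + b_f
    rw [map_add, LinearIsometryEquiv.trans_apply, LinearIsometryEquiv.apply_symm_apply, LinearIsometryEquiv.apply_symm_apply]
    abel
  have hpt₂ : ∀ r : E3, rigid M t (L₂ r + s₂) = L_g r + b_g := fun r => by
    show M ((L_g.trans M.symm) r + M.symm (b_g - t)) + t = L_g r + b_g
    rw [map_add, LinearIsometryEquiv.trans_apply, LinearIsometryEquiv.apply_symm_apply, LinearIsometryEquiv.apply_symm_apply]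
    abel
  have himg₁ : rigid M t '' stacking L₁ s₁ σ_f = stacking L_f b_f σ_f := by
    rw [rigid_image_stacking, hL₁, hs₁, trans_symm_trans_self, apply_symm_sub_add]
  have himg₂ : rigid M t '' stacking L₂ s₂ σ_g = stacking L_g b_g σ_g := by
    rw [rigid_image_stacking, hL₂, hs₂, trans_symm_trans_self, apply_symm_sub_add]
  have hmem₁ : ∀ p, p ∈ stacking L₁ s₁ σ_f → rigid M t p ∈ stacking L_f b_f σ_f := fun p hp => by
    rw [← himg₁]; exact ⟨p, hp, rfl⟩
  have hmem₂ : ∀ p, p ∈ stacking L₂ s₂ σ_g → rigid M t p ∈ stacking L_g b_g σ_g := fun p hp => by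
    rw [← himg₂]; exact ⟨p, hp, rfl⟩
  have hsymm : ∀ p : E3, M.symm (rigid M t p - t) = p := fun p => by
    show M.symm (M p + t - t) = p
    rw [add_sub_cancel_right, LinearIsometryEquiv.symm_apply_apply]
  have hc₁ : ∀ p ∈ stacking L₁ s₁ σ_f, -(2 * R₀) ≤ p 2 → p 2 ≤ -R₀ → p 0 ^ 2 + p 1 ^ 2 ≤ ρ ^ 2 → p ∈ pullback X' M t := by
    intro p hp h1 h2 h3
    rw [mem_pullback_iff]
    have hw := hf (rigid M t p) (hmem₁ p hp)
    rw [hsymm] at hw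
    exact hw h1 h2 h3
  have hc₂ : ∀ p ∈ stacking L₂ s₂ σ_g, h + R₀ ≤ p 2 → p 2 ≤ h + 2 * R₀ → p 0 ^ 2 + p 1 ^ 2 ≤ ρ ^ 2 → p ∈ pullback X' M t := by
    intro p hp h1 h2 h3
    rw [mem_pullback_iff]
    have hw := hg (rigid M t p) (hmem₂ p hp)
    rw [hsymm] at hw
    exact hw h1 h2 h3
  refine ⟨PlacedCell.ofComplete C R₀ hσ_f hσ_g L₁ L₂ s₁ s₂ hR₀ hh hρ X' M t hc₁ hc₂ hX', rfl, rfl, rfl, rfl, ⟨hpt₁, rfl⟩, ⟨hpt₂, rfl⟩,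
    himg₁, himg₂, ?_, ?_⟩
  · intro i j
    exact WallCell.ofComplete_full C R₀ hσ_f hσ_g L₁ L₂ s₁ s₂ hR₀ hh hρ (pullback X' M t) (pullback_sep X' M t hX') hc₁ hc₂ i j
  · intro q hq hcyl
    have hqp : M.symm (q - t) ∈ pullback X' M t := by
      rw [mem_pullback_iff]
      have : rigid M t (M.symm (q - t)) = q := rigid_symm_apply M t q
      rw [this]; exact hq
    exact WallCell.ofComplete_mem_X C R₀ hσ_f hσ_g L₁ L₂ s₁ s₂ hR₀ hh hρ (pullback X' M t) (pullback_sep X' M t hX') hc₁ hc₂ hqp hcyl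

end CellPres


end Summit.Ventures.Crystal3D.Cruxes.TextureLiminf.TexShadow

end
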